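import Summits.BirchSwinnertonDyer.BirchSwinnertonDyer.Theorems.CMKolyvaginAtInertTwoPlusPartDescentAtTwoPow
import HarnessLib

/-!
# Route `CMKolyvaginAtInertTwo`, crux `CMKolyvaginExactAtInertTwo` (stmt-BirchSwinnertonDyer-24277):
# KOLYVAGIN'S ANNIHILATOR AT `p = 2`, LEVEL `2^M`, MODULO ENTANGLEMENT — the `(−ε)`-part, the
# `τ`-part and the `ε`-part two-prime step combined: `2^{M−a+k+1}·s ∈ ℤ·δ(y_K)` for every
# `s ∈ Sel_{2^M}(E/K)` whose `ε`-part is disentangled from `δ(y_K)` at depth `k`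

Seat `bsd-line-cmk2-p1` g7 (cell `bsd-print-cf2`); helper (`--supports stmt-BirchSwinnertonDyer-24277`).
THEOREMS ONLY: no definition, no named fact, no `sorry`; no item is closed; BSD is not proved by this.
All statements in ty2's DATA currency (`PointSystemFamily` / `ReciprocityFamily` at `p = 2`, p601266).

* `kummerMapTorsion_mem_selmerGroup_and_conjAct` — from the point system: `δ(y_K) ∈ Sel_{2^M}(E/K)`
  and `c_* δ(y_K) = ε δ(y_K)` (Gross Prop. 5.3 at `m = 1` in class form; `ε` the sign of `y_K`).
* `two_pow_smul_selmer_plus_eq_zero_of_indep_of_families_two_pow` — the `ε`-part two-prime step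
  (`…PlusPartDescentAtTwoPow`) on ty2's data.
* `exists_two_pow_smul_eq_zsmul_of_coset_indep` — **`ε`-part, coset form**: `t ∈ Sel^{ε}`, `k`, `λ`
  with `ℤ(2^k t − λ δy_K) ∩ ℤδy_K = 0` ⟹ `2^{M−a+k} t ∈ ℤ δy_K`.
* `exists_two_pow_smul_eq_zsmul_of_families_two_pow` — **THE ANNIHILATOR MODULO ENTANGLEMENT**: for
  ANY `s ∈ Sel_{2^M}(E/K)`, if its `ε`-part `s⁺ = s + ε c_* s` admits `k`, `λ` with
  `ℤ(2^k s⁺ − λ δy_K) ∩ ℤδy_K = 0`, then **`2^{M−a+k+1}·s ∈ ℤ·δ(y_K)`** (`(−ε)`-part: `2^{M−a}(s − εc_*s)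
  = 0`, p618706/p620411; `2s = s⁺ + s⁻`). With `a = M−1−M₀`, `k = 0`: `2^{M₀+2} s ∈ ℤδy_K` — memo R1's
  «first rung for H₂» (Kolyvagin's theorem at `2` as an ANNIHILATOR, exponent `M₀ + 2`, two bits
  above odd `p`), GRANTED disentanglement.

HONEST FRAMING — THE ENTANGLEMENT DEFECT (new, `p = 2` only). For an `ε`-eigen `t` let `2^m` be the
order of `t` modulo `ℤδy_K` and `2^m t = 2^b β' δy_K` (`β'` odd). If `b ≥ min(m, ord-exponent of δy_K)`
some translate `t − λδy_K` is disentangled (`k = 0`). Otherwise every translate of `2^k t`, `k < m−b`,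
meets `ℤδy_K` non-trivially — the two-prime step cannot even choose its first prime (`(s)_{λ₁} = 0`
forces `ord (δy_K)_{λ₁} ≤ 2^b`) — and the best disentangled multiple is `2^{m−b} t − β'δy_K`, giving
`2^{M−a+m−b} t ∈ ℤδy_K`: a LOSS of `m − b` bits, which measures how far `δy_K` is `2`-divisible
INSIDE `ℤt + ℤδy_K ⊆ Sel` (an `Ш(E/K)[2]`-phenomenon, cf. the invisible `τ`-invariant order-`2` classes
of memo §1). At odd `p` the `±`-eigenspaces are complementary and `m = b` always. So even the
annihilator form of Kolyvagin's theorem at `2` carries, class by class, a defect controlled by `2`-power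
divisibility of `y_K` in the Selmer group — not by `[E(K) : ℤy_K]` alone. Nothing here bounds
`#Sel₂(E/K)^τ`; the crux's ORDER statement is untouched. Hypotheses at `2` not in print: ty2's data,
`hcomm`. References: [McCallumLMS1991] §1 Theorem, §5; [GrossLMS1991] Props. 2.1, 2.3, §10;
[Kolyvagin1989Izv] Thm. B; memo + KERNEL-STATUS (v6).
-/

-- single-conjunct summit: `Summit.BirchSwinnertonDyer.BirchSwinnertonDyer.…` repeats the name by design
set_option linter.dupNamespace false
set_option autoImplicit false

noncomputable section

open scoped Classical
open WeierstrassCurve NumberField IsDedekindDomain Field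
open Literature.NumberTheory.GaloisRepresentations Literature.NumberTheory.EllipticCurves

namespace Summit.BirchSwinnertonDyer.BirchSwinnertonDyer.Theorems.KolyvaginDescentTwo

variable (W : WeierstrassCurve ℚ) {K : Type} [Field K] [NumberField K]

/-- **`δ(y_K)` is Selmer and `c_* δ(y_K) = ε δ(y_K)`**, from a point system at `p = 2`, level `M`
(Gross Prop. 5.3 at `m = 1`: `τ y_K = ε y_K + 2^M B` in `A_1`, in class form; the Kummer image of a
rational point is Selmer). [cite: GrossLMS1991, Prop. 5.3, (4.4)] -/
theorem kummerMapTorsion_mem_selmerGroup_and_conjAct {N : ℕ} [NeZero N] [W.IsElliptic]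
    {P : (W.baseChange K).toAffine.Point} (hnt : ¬ IsOfFinAddOrder P)
    {c : K ≃ₐ[ℚ] K} (hc : c ≠ 1) {M : ℕ} (hM : 1 ≤ M)
    (hdiv : ∀ Q : geomPoints (W.baseChange K), ∃ R, ((2 ^ M : ℕ) : ℤ) • R = Q)
    {ε : ℤ} (hε : ε = 1 ∨ ε = -1)
    (hPε : IsOfFinAddOrder (Affine.Point.map (W' := W) (c : K →ₐ[ℚ] K) P - ε • P))
    (D : Rank1Residual.P2.KolyvaginMachine.PointSystemFamily N W K P 2 fun _ ↦ True) :
    kummerMapTorsion (W.baseChange K) _ hdiv P ∈ selmerGroup (W.baseChange K) ((2 ^ M : ℕ) : ℤ) ∧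
      conjAct W c ((2 ^ M : ℕ) : ℤ) (kummerMapTorsion (W.baseChange K) _ hdiv P) =
        ε • kummerMapTorsion (W.baseChange K) _ hdiv P := by
  refine ⟨(mem_selmerGroup_iff _ _ _).mpr ⟨fun _ ↦ kummerMapTorsion_mem_selmerLocalKer _ _ _ _ P,
    fun _ ↦ kummerMapTorsion_mem_selmerLocalKer _ _ _ _ P⟩, ?_⟩
  obtain ⟨ε₀, τ, hτ, A, hA, Pt, hPt, hε₀, h53, hAτ, hPt1, hrel⟩ :=
    Rank1Residual.P2.KolyvaginMachine.hpoints_of_pointSystemFamily D hM hdiv c hc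
  have hneg := not_isOfFinAddOrder_map_sub_neg_smul W hnt c hε hPε
  have hεε₀ : ε₀ = ε := by
    rcases hε₀ with rfl | rfl <;> rcases hε with rfl | rfl
    · rfl
    · rw [neg_neg] at hneg; exact absurd h53 hneg
    · exact absurd h53 hneg
    · rfl
  have hP1 : toGeomPoints (W.baseChange K) P ∈
      KolyvaginCocycle.invPoints (Field.absoluteGaloisGroup K) (A 1) ((2 ^ M : ℕ) : ℤ) := by
    rw [← hPt1]; exact hPt 1
  have hc1 : kolyvaginClass (W.baseChange K) _ hdiv (hA 1) (Pt 1) (hPt 1) =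
      kummerMapTorsion (W.baseChange K) _ hdiv P := by
    rw [KolyvaginDescent.kolyvaginClass_congr_point (hA 1) (hP' := hP1) hPt1]
    exact kolyvaginClass_toGeomPoints (hA 1) P hP1
  have hone : ∀ q' ∈ (1 : ℕ).primeFactors, IsKolyvaginPrime N W K 2 q' ∧
      FrobEqFrobInfty W K (2 ^ M) q' ∧ True := fun q' hq' ↦ absurd hq' (by simp)
  have h := conjAct_kolyvaginClass_eq_smul W (hdiv := hdiv) hτ (hA 1) (hAτ 1) (hPt 1) _
    (hrel 1 squarefree_one hone).1
  rw [hc1, Nat.primeFactors_one, Finset.card_empty, pow_zero, mul_one, hεε₀] at h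
  exact h

/-- **The `ε`-part two-prime step on ty2's DATA** (`…PlusPartDescentAtTwoPow` with the binders
produced from `PointSystemFamily` / `ReciprocityFamily` at level `M`).
[cite: McCallumLMS1991, §5 Lemma 5.1, Prop. 5.2, Lemma 5.3, Thm. 5.4] [cite: GrossLMS1991, Props. 2.1, 2.3, §10] -/
theorem two_pow_smul_selmer_plus_eq_zero_of_indep_of_families_two_pow {N : ℕ} [NeZero N]
    [W.IsElliptic] (hK : IsImaginaryQuadratic K) {P : (W.baseChange K).toAffine.Point}
    (hP : IsHeegnerPoint N W K P) (hnt : ¬ IsOfFinAddOrder P)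
    (hρ : W.HasSurjectiveModNGaloisRep 2) (hΔ : W.Δ < 0) (hΔK : ¬ IsSquare (W.baseChange K).Δ)
    {c : K ≃ₐ[ℚ] K} (hc : c ≠ 1) {M : ℕ} (hM : 1 ≤ M) {z : absoluteGaloisGroup K}
    (hzfix : ∀ T : geomTorsion (W.baseChange K) ((2 : ℕ) : ℤ), z • T = T → T = 0)
    (hcomm : ∀ π ∈ torsionFixing (W.baseChange K) ((2 : ℕ) : ℤ),
      ∀ T : geomTorsion (W.baseChange K) ((2 ^ M : ℕ) : ℤ), π • z • T = z • π • T)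
    {a : ℕ} (ha : a < M)
    (hy : ∀ Q : (W.baseChange K).toAffine.Point, ((2 ^ M : ℕ) : ℤ) • Q ≠ ((((2 : ℕ) : ℤ) ^ a)) • P)
    {ε : ℤ} (hε : ε = 1 ∨ ε = -1)
    (hPε : IsOfFinAddOrder (Affine.Point.map (W' := W) (c : K →ₐ[ℚ] K) P - ε • P))
    (D : Rank1Residual.P2.KolyvaginMachine.PointSystemFamily N W K P 2 fun _ ↦ True)
    (R : Rank1Residual.P2.KolyvaginMachine.ReciprocityFamily N W K 2 fun _ ↦ True) :
    ∀ s ∈ selmerGroup (W.baseChange K) ((2 ^ M : ℕ) : ℤ), conjAct W c ((2 ^ M : ℕ) : ℤ) s = ε • s →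
      (∀ (hdiv : ∀ Q : geomPoints (W.baseChange K), ∃ R, ((2 ^ M : ℕ) : ℤ) • R = Q) (α β : ℤ),
        α • s + β • kummerMapTorsion (W.baseChange K) ((2 ^ M : ℕ) : ℤ) hdiv P = 0 → α • s = 0) →
      (((2 : ℕ) : ℤ) ^ (M - a)) • s = 0 := by
  refine two_pow_smul_selmer_plus_eq_zero_of_indep_two_pow W hK hP hnt hρ hΔ hΔK hc hM (q := 2 ^ M)
    rfl hzfix hcomm ha hy hε hPε ?_ ?_
  · intro hdiv
    obtain ⟨ε', τ, hτ, A, hA, Pt, hPt, hε', h53, hAτ, hPt1, hm'⟩ :=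
      Rank1Residual.P2.KolyvaginMachine.hpoints_of_pointSystemFamily D hM hdiv c hc
    exact ⟨ε', τ, hτ, A, hA, Pt, hPt, hε', h53, hAτ, hPt1, fun m hm hq ↦
      hm' m hm fun q hq' ↦ ⟨(hq q hq').1, (hq q hq').2, trivial⟩⟩
  · intro ℓ hℓ hF
    exact Rank1Residual.P2.KolyvaginMachine.hRT_of_reciprocityFamily R hM hℓ hF trivial

/-- **`ε`-part, coset form**: for `t ∈ Sel_{2^M}(E/K)` with `c_* t = ε t` and `k`, `λ` such that
`t' = 2^k t − λ δ(y_K)` is disentangled from `δ(y_K)` (`α t' + β δy_K = 0 ⟹ α t' = 0`), one has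
`2^{M−a+k} t = r δ(y_K)` for some `r ∈ ℤ` (apply the two-prime step to `t'`).
[cite: McCallumLMS1991, §5 Lemma 5.1, Thm. 5.4] [cite: GrossLMS1991, Prop. 2.3] -/
theorem exists_two_pow_smul_eq_zsmul_of_coset_indep {N : ℕ} [NeZero N]
    [W.IsElliptic] (hK : IsImaginaryQuadratic K) {P : (W.baseChange K).toAffine.Point}
    (hP : IsHeegnerPoint N W K P) (hnt : ¬ IsOfFinAddOrder P)
    (hρ : W.HasSurjectiveModNGaloisRep 2) (hΔ : W.Δ < 0) (hΔK : ¬ IsSquare (W.baseChange K).Δ)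
    {c : K ≃ₐ[ℚ] K} (hc : c ≠ 1) {M : ℕ} (hM : 1 ≤ M) {z : absoluteGaloisGroup K}
    (hzfix : ∀ T : geomTorsion (W.baseChange K) ((2 : ℕ) : ℤ), z • T = T → T = 0)
    (hcomm : ∀ π ∈ torsionFixing (W.baseChange K) ((2 : ℕ) : ℤ),
      ∀ T : geomTorsion (W.baseChange K) ((2 ^ M : ℕ) : ℤ), π • z • T = z • π • T)
    {a : ℕ} (ha : a < M)
    (hy : ∀ Q : (W.baseChange K).toAffine.Point, ((2 ^ M : ℕ) : ℤ) • Q ≠ ((((2 : ℕ) : ℤ) ^ a)) • P)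
    {ε : ℤ} (hε : ε = 1 ∨ ε = -1)
    (hPε : IsOfFinAddOrder (Affine.Point.map (W' := W) (c : K →ₐ[ℚ] K) P - ε • P))
    (D : Rank1Residual.P2.KolyvaginMachine.PointSystemFamily N W K P 2 fun _ ↦ True)
    (R : Rank1Residual.P2.KolyvaginMachine.ReciprocityFamily N W K 2 fun _ ↦ True)
    (hdiv : ∀ Q : geomPoints (W.baseChange K), ∃ R, ((2 ^ M : ℕ) : ℤ) • R = Q)
    {t : galH1Torsion (W.baseChange K) ((2 ^ M : ℕ) : ℤ)}
    (ht : t ∈ selmerGroup (W.baseChange K) ((2 ^ M : ℕ) : ℤ))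
    (htε : conjAct W c ((2 ^ M : ℕ) : ℤ) t = ε • t) (k : ℕ) (lam : ℤ)
    (hind : ∀ α β : ℤ,
      α • ((((2 : ℕ) : ℤ) ^ k) • t - lam • kummerMapTorsion (W.baseChange K) _ hdiv P) +
        β • kummerMapTorsion (W.baseChange K) _ hdiv P = 0 →
      α • ((((2 : ℕ) : ℤ) ^ k) • t - lam • kummerMapTorsion (W.baseChange K) _ hdiv P) = 0) :
    ∃ r : ℤ, (((2 : ℕ) : ℤ) ^ (M - a + k)) • t = r • kummerMapTorsion (W.baseChange K) _ hdiv P := by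
  obtain ⟨hδS, hδε⟩ := kummerMapTorsion_mem_selmerGroup_and_conjAct W hnt hc hM hdiv hε hPε D
  set δP := kummerMapTorsion (W.baseChange K) _ hdiv P with hδP
  set t' := (((2 : ℕ) : ℤ) ^ k) • t - lam • δP with ht'
  have ht'S : t' ∈ selmerGroup (W.baseChange K) ((2 ^ M : ℕ) : ℤ) :=
    sub_mem (AddSubgroup.zsmul_mem _ ht _) (AddSubgroup.zsmul_mem _ hδS _)
  have ht'ε : conjAct W c ((2 ^ M : ℕ) : ℤ) t' = ε • t' := by
    rw [ht', map_sub, map_zsmul, map_zsmul, htε, hδε, zsmul_sub, smul_comm _ ε t, smul_comm lam ε]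
  have hkill := two_pow_smul_selmer_plus_eq_zero_of_indep_of_families_two_pow W hK hP hnt hρ hΔ hΔK hc
    hM hzfix hcomm ha hy hε hPε D R t' ht'S ht'ε (fun hdiv' α β h ↦ hind α β h)
  refine ⟨(((2 : ℕ) : ℤ) ^ (M - a)) * lam, ?_⟩
  rw [pow_add, ← smul_smul, ← smul_smul, ← sub_eq_zero, ← zsmul_sub]
  exact hkill

/-- **KOLYVAGIN'S ANNIHILATOR AT `p = 2` MODULO ENTANGLEMENT** (module docstring): for every
`s ∈ Sel_{2^M}(E/K)`, if the `ε`-part `s⁺ = s + ε c_* s` admits `k`, `λ` with `2^k s⁺ − λ δy_K`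
disentangled from `δy_K`, then `2^{M−a+k+1}·s = r·δ(y_K)` for some `r ∈ ℤ`. With `a = M − 1 − M₀`
(`2^{M₀} ∥ y_K`) and `k = 0`: `2^{M₀+2} s ∈ ℤ δ(y_K)`.
[cite: McCallumLMS1991, §1 Theorem (Kolyvagin), §5] [cite: GrossLMS1991, Thm. 1.3, Props. 2.1, 2.3] -/
theorem exists_two_pow_smul_eq_zsmul_of_families_two_pow {N : ℕ} [NeZero N]
    [W.IsElliptic] (hK : IsImaginaryQuadratic K) {P : (W.baseChange K).toAffine.Point}
    (hP : IsHeegnerPoint N W K P) (hnt : ¬ IsOfFinAddOrder P)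
    (hρ : W.HasSurjectiveModNGaloisRep 2) (hΔ : W.Δ < 0) (hΔK : ¬ IsSquare (W.baseChange K).Δ)
    {c : K ≃ₐ[ℚ] K} (hc : c ≠ 1) {M : ℕ} (hM : 1 ≤ M) {z : absoluteGaloisGroup K}
    (hzfix : ∀ T : geomTorsion (W.baseChange K) ((2 : ℕ) : ℤ), z • T = T → T = 0)
    (hcomm : ∀ π ∈ torsionFixing (W.baseChange K) ((2 : ℕ) : ℤ),
      ∀ T : geomTorsion (W.baseChange K) ((2 ^ M : ℕ) : ℤ), π • z • T = z • π • T)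
    {a : ℕ} (ha : a < M)
    (hy : ∀ Q : (W.baseChange K).toAffine.Point, ((2 ^ M : ℕ) : ℤ) • Q ≠ ((((2 : ℕ) : ℤ) ^ a)) • P)
    {ε : ℤ} (hε : ε = 1 ∨ ε = -1)
    (hPε : IsOfFinAddOrder (Affine.Point.map (W' := W) (c : K →ₐ[ℚ] K) P - ε • P))
    (D : Rank1Residual.P2.KolyvaginMachine.PointSystemFamily N W K P 2 fun _ ↦ True)
    (R : Rank1Residual.P2.KolyvaginMachine.ReciprocityFamily N W K 2 fun _ ↦ True)
    (hdiv : ∀ Q : geomPoints (W.baseChange K), ∃ R, ((2 ^ M : ℕ) : ℤ) • R = Q)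
    {s : galH1Torsion (W.baseChange K) ((2 ^ M : ℕ) : ℤ)}
    (hs : s ∈ selmerGroup (W.baseChange K) ((2 ^ M : ℕ) : ℤ)) (k : ℕ) (lam : ℤ)
    (hind : ∀ α β : ℤ,
      α • ((((2 : ℕ) : ℤ) ^ k) • (s + ε • conjAct W c ((2 ^ M : ℕ) : ℤ) s) -
          lam • kummerMapTorsion (W.baseChange K) _ hdiv P) +
        β • kummerMapTorsion (W.baseChange K) _ hdiv P = 0 →
      α • ((((2 : ℕ) : ℤ) ^ k) • (s + ε • conjAct W c ((2 ^ M : ℕ) : ℤ) s) -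
          lam • kummerMapTorsion (W.baseChange K) _ hdiv P) = 0) :
    ∃ r : ℤ, (((2 : ℕ) : ℤ) ^ (M - a + k + 1)) • s =
      r • kummerMapTorsion (W.baseChange K) _ hdiv P := by
  haveI : Algebra.IsQuadraticExtension ℚ K := ⟨hK.1⟩
  haveI : IsTotallyComplex K := hK.2
  have hcard : Nat.card (K ≃ₐ[ℚ] K) = 2 := by rw [IsGalois.card_aut_eq_finrank, hK.1]
  have hcc : c * c = 1 := by
    have h := pow_card_eq_one' (G := K ≃ₐ[ℚ] K) (x := c)
    rwa [hcard, pow_two] at h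
  have hεε : ε * ε = 1 := by rcases hε with rfl | rfl <;> norm_num
  -- the `ε`-part `s⁺`
  set sp := s + ε • conjAct W c ((2 ^ M : ℕ) : ℤ) s with hsp
  have hspS : sp ∈ selmerGroup (W.baseChange K) ((2 ^ M : ℕ) : ℤ) :=
    add_mem hs (AddSubgroup.zsmul_mem _
      (conjAct_mem_selmerGroup W (fun w ↦ IsTotallyComplex.isComplex w) c _ hs) ε)
  have hspε : conjAct W c ((2 ^ M : ℕ) : ℤ) sp = ε • sp := by
    rw [hsp, map_add, map_zsmul, conjAct_conjAct_of_mul_self W hcc, zsmul_add, smul_smul, hεε,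
      one_zsmul, add_comm]
  obtain ⟨r, hr⟩ := exists_two_pow_smul_eq_zsmul_of_coset_indep W hK hP hnt hρ hΔ hΔK hc hM hzfix
    hcomm ha hy hε hPε D R hdiv hspS hspε k lam hind
  -- the `(−ε)`-part `s⁻`: `2^{M-a}(s − ε c_* s) = 0`
  have hminus := two_pow_smul_sub_conjAct_eq_zero_of_families_two_pow W hK hP hnt hρ hΔ hΔK hc hM
    hzfix hcomm ha hy hε hPε D R s hs
  refine ⟨r, ?_⟩
  -- `2^{M-a+k+1} s = 2^{M-a+k} (s⁺ + s⁻) = r δP + 2^k · 0`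
  have e2 : (((2 : ℕ) : ℤ) ^ (M - a + k)) • sp +
        (((2 : ℕ) : ℤ) ^ k) • ((((2 : ℕ) : ℤ) ^ (M - a)) • (s - ε • conjAct W c ((2 ^ M : ℕ) : ℤ) s)) =
      (((2 : ℕ) : ℤ) ^ (M - a + k + 1)) • s := by
    rw [smul_smul, ← pow_add, show k + (M - a) = M - a + k by omega, ← zsmul_add, hsp,
      show s + ε • conjAct W c ((2 ^ M : ℕ) : ℤ) s + (s - ε • conjAct W c ((2 ^ M : ℕ) : ℤ) s) =
        ((2 : ℕ) : ℤ) • s by rw [show (((2 : ℕ) : ℤ)) = 2 by norm_num, two_zsmul]; abel,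
      smul_smul, ← pow_succ]
  rw [← e2, hr, hminus, zsmul_zero, add_zero]

end Summit.BirchSwinnertonDyer.BirchSwinnertonDyer.Theorems.KolyvaginDescentTwo

end
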